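import Mathlib
import HarnessLib
import Summits.KontsevichZagierPeriods.Zeta5Search.SorokinLastVariable
import Summits.KontsevichZagierPeriods.Zeta5Search.BarnesEulerIntegralCut

/-!
# ζ(5) search — Zudilin's Lemma 3, fibrewise: the Euler integral of the last variable as a Barnes integral (cell `pub-zeta5`, ct-1 g27)

HONEST FRAMING: systematic search; no irrationality claim unless kernel-certified.  Identities of special functions (pointwise in
the remaining variables); nothing here is an irrationality result, a worthiness exponent or a denominator statement; no named
fact is discharged; no definition is introduced.

Second piece of brick B3 (Zudilin math/0206177, Lemma 3) of `HOME/ct-1/g26/VWP-BLUEPRINT.md`.  By `SorokinLastVariable.setIntegral_succ_eq`,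
`J_{k+1} = ∫_{[0,1]^k} C(x') · eulerIntegral a₀ a_k b_k (z(x')) dx'` with `C(x') = ∏_{j<k} x'_j^{a_j−1}(1−x'_j)^{b_j−a_j−1} Q_k(x')^{−a₀}`,
`z = (−1)^k ∏x'_j/Q_k(x')`.  Here, for `x'` in the OPEN cube:

* `cpow_prod_div` — `(∏ x'_j / Q)^{s} = ∏ (x'_j)^{s} · Q^{−s}` (principal powers of positive reals; `r^e = exp(e log r)`);
* `shifted_integrand_eq` — `C(x') · |z|^{s}` is the integrand of `J_k(a₀+s; a_j+s | b_j+s)` at `x'` (exponents shift by `s`);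
* `fibre_eq` — **`C(x') · eulerIntegral a₀ a_k b_k z = Γ(b_k−a_k)/Γ(a₀) · (1/2π) ∫_ℝ K(y) e^{iεπs} · [J_k(a₀+s; a+s | b+s)-integrand at x'] dy`**,
  `s = −t₀+iy`, `K(y) = Γ(a₀+s)Γ(a_k+s)Γ(−s)/Γ(b_k+s)`, where the PARITY of `k` picks the case of Lemma 2: `k` odd ⇒ `z < 0`
  (`BarnesEulerIntegral.eulerIntegral_neg_eq_barnes`, `ε = 0`), `k` even ⇒ `0 < z < 1` (`BarnesEulerIntegralCut.eulerIntegral_pos_eq_barnes`,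
  `ε = ±1`) — Zudilin's `e^{ε_k πit}`; hypotheses `0 < t₀ < Re a₀`, `t₀ < Re a_k`, `Re a₀ + Re a_k < Re b_k` as in Lemma 2.

The remaining Fubini over `[0,1]^k × ℝ` (the integral form of Lemma 3) is in the sequel file.  Theorems only.
-/

noncomputable section

namespace Summit.KontsevichZagierPeriods.Zeta5Search.SorokinLemma3Fibre

open MeasureTheory Set Filter
open scoped Real
open Literature.NumberTheory.Irrationality.Zudilin2002 (nestedQ)
open Literature.Analysis.SpecialFunctions.Hypergeometric (eulerIntegral)
open Summit.KontsevichZagierPeriods.Zeta5Search.SorokinIntegrandBounds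
open Summit.KontsevichZagierPeriods.Zeta5Search.NestedQSecondRecursion

variable {t₀ : ℝ} {a₀ : ℂ} {a b : ℕ → ℂ}

/-! ### 1. Powers of positive reals -/

/-- **`(∏ x_j / Q)^s = ∏ x_j^s · Q^{−s}`** for positive reals `x_j`, `Q` and complex `s` (principal powers). -/
theorem cpow_prod_div {k : ℕ} {x : Fin k → ℝ} (hx : ∀ j, 0 < x j) {Q : ℝ} (hQ : 0 < Q) (s : ℂ) :
    ((((∏ j, x j) / Q : ℝ)) : ℂ) ^ s = (∏ j, ((x j : ℝ) : ℂ) ^ s) * ((Q : ℂ)) ^ (-s) := by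
  have hP : 0 < ∏ j, x j := Finset.prod_pos fun j _ => hx j
  -- `(r : ℂ)^e = exp (log r · e)` for `r > 0` (the tree's `Literature.NumberTheory.LFunctions.NumberField.ofReal_cpow_eq_exp`,
  -- inlined here to keep the imports light)
  have hexp : ∀ {r : ℝ}, 0 < r → ∀ e : ℂ, ((r : ℂ)) ^ e = Complex.exp ((Real.log r : ℂ) * e) := fun hr e => by
    rw [Complex.cpow_def_of_ne_zero (Complex.ofReal_ne_zero.mpr hr.ne'), Complex.ofReal_log hr.le]
  rw [hexp (div_pos hP hQ), hexp hQ, Finset.prod_congr rfl fun j _ => hexp (hx j) s, ← Complex.exp_sum, ← Complex.exp_add,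
    Real.log_div hP.ne' hQ.ne', Real.log_prod (s := Finset.univ) (f := x) (fun j _ => (hx j).ne')]
  push_cast
  congr 1
  rw [sub_mul, Finset.sum_mul]
  ring

/-- **Shifting the exponents**: on the open cube, `C(x') · (∏x'_j/Q_k)^s` is the integrand of `J_k(a₀+s; a_j+s | b_j+s)` at `x'`. -/
theorem shifted_integrand_eq {k : ℕ} (hk : 1 ≤ k) (a₀ : ℂ) (a b : ℕ → ℂ) {x : Fin k → ℝ} (hx : ∀ j, x j ∈ Ioo (0 : ℝ) 1)
    (s : ℂ) :
    (∏ j : Fin k, ((x j : ℝ) : ℂ) ^ (a j - 1) * (1 - ((x j : ℝ) : ℂ)) ^ (b j - a j - 1)) *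
          ((nestedQ (List.ofFn x) : ℝ) : ℂ) ^ (-a₀) *
        ((((∏ j, x j) / nestedQ (List.ofFn x) : ℝ)) : ℂ) ^ s =
      (∏ j : Fin k, ((x j : ℝ) : ℂ) ^ ((a j + s) - 1) * (1 - ((x j : ℝ) : ℂ)) ^ ((b j + s) - (a j + s) - 1)) *
        ((nestedQ (List.ofFn x) : ℝ) : ℂ) ^ (-(a₀ + s)) := by
  have hQ := (nestedQ_ofFn_mem_Ioo hk hx).1
  have hQc : ((nestedQ (List.ofFn x) : ℝ) : ℂ) ≠ 0 := by exact_mod_cast hQ.ne'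
  rw [cpow_prod_div (fun j => (hx j).1) hQ s]
  calc (∏ j : Fin k, ((x j : ℝ) : ℂ) ^ (a j - 1) * (1 - ((x j : ℝ) : ℂ)) ^ (b j - a j - 1)) *
          ((nestedQ (List.ofFn x) : ℝ) : ℂ) ^ (-a₀) * ((∏ j, ((x j : ℝ) : ℂ) ^ s) * ((nestedQ (List.ofFn x) : ℝ) : ℂ) ^ (-s))
      = (∏ j : Fin k, ((x j : ℝ) : ℂ) ^ (a j - 1) * (1 - ((x j : ℝ) : ℂ)) ^ (b j - a j - 1) * ((x j : ℝ) : ℂ) ^ s) *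
          (((nestedQ (List.ofFn x) : ℝ) : ℂ) ^ (-a₀) * ((nestedQ (List.ofFn x) : ℝ) : ℂ) ^ (-s)) := by
        have hd : (∏ j : Fin k, ((x j : ℝ) : ℂ) ^ (a j - 1) * (1 - ((x j : ℝ) : ℂ)) ^ (b j - a j - 1) * ((x j : ℝ) : ℂ) ^ s) =
            (∏ j : Fin k, ((x j : ℝ) : ℂ) ^ (a j - 1) * (1 - ((x j : ℝ) : ℂ)) ^ (b j - a j - 1)) * ∏ j : Fin k, ((x j : ℝ) : ℂ) ^ s :=
          Finset.prod_mul_distrib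
        rw [hd]; ring
    _ = _ := by
        rw [← Complex.cpow_add _ _ hQc, show -a₀ + -s = -(a₀ + s) by ring]
        congr 1
        refine Finset.prod_congr rfl fun j _ => ?_
        have hxc : ((x j : ℝ) : ℂ) ≠ 0 := by exact_mod_cast (hx j).1.ne'
        rw [mul_right_comm, ← Complex.cpow_add _ _ hxc]
        congr 1
        · congr 1; ring
        · congr 1; ring

/-! ### 2. The fibre identity -/

/-- **Lemma 3 on a fibre** [Zudilin math/0206177, Lemma 3 with Lemma 2]: for `k ≥ 1`, `x'` in the open cube, complex `a₀, a_j, b_j`,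
a real `t₀` with `0 < t₀ < Re a₀`, `t₀ < Re a_k`, `Re a₀ + Re a_k < Re b_k`, and `ε = 0` if `k` is odd (`z < 0`), `ε = ±1` if `k`
is even (`0 < z < 1`):
`C(x') · eulerIntegral a₀ a_k b_k z = Γ(b_k−a_k)/Γ(a₀) · (1/2π) ∫_ℝ K(y) e^{iεπs} · [integrand of J_k(a₀+s; a+s | b+s) at x'] dy`. -/
theorem fibre_eq {k : ℕ} (hk : 1 ≤ k) (ht₀ : 0 < t₀) (ht₀' : t₀ < a₀.re) (hta : t₀ < (a k).re)
    (hb : a₀.re + (a k).re < (b k).re) {x : Fin k → ℝ} (hx : ∀ j, x j ∈ Ioo (0 : ℝ) 1) {ε : ℝ}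
    (hε : (Odd k ∧ ε = 0) ∨ (Even k ∧ (ε = 1 ∨ ε = -1))) :
    (∏ j : Fin k, ((x j : ℝ) : ℂ) ^ (a j - 1) * (1 - ((x j : ℝ) : ℂ)) ^ (b j - a j - 1)) *
          ((nestedQ (List.ofFn x) : ℝ) : ℂ) ^ (-a₀) *
        eulerIntegral a₀ (a k) (b k) ((((-1) ^ k * (∏ j, x j) / nestedQ (List.ofFn x) : ℝ)) : ℂ) =
      Complex.Gamma (b k - a k) / Complex.Gamma a₀ *
        ((1 / (2 * π) : ℂ) * ∫ y : ℝ,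
          Complex.Gamma (a₀ + (-(t₀ : ℂ) + (y : ℂ) * Complex.I)) * Complex.Gamma (a k + (-(t₀ : ℂ) + (y : ℂ) * Complex.I)) *
                Complex.Gamma (-(-(t₀ : ℂ) + (y : ℂ) * Complex.I)) /
                Complex.Gamma (b k + (-(t₀ : ℂ) + (y : ℂ) * Complex.I)) *
              Complex.exp (ε * π * Complex.I * (-(t₀ : ℂ) + (y : ℂ) * Complex.I)) *
            ((∏ j : Fin k, ((x j : ℝ) : ℂ) ^ ((a j + (-(t₀ : ℂ) + (y : ℂ) * Complex.I)) - 1) *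
                (1 - ((x j : ℝ) : ℂ)) ^ ((b j + (-(t₀ : ℂ) + (y : ℂ) * Complex.I)) - (a j + (-(t₀ : ℂ) + (y : ℂ) * Complex.I)) - 1)) *
              ((nestedQ (List.ofFn x) : ℝ) : ℂ) ^ (-(a₀ + (-(t₀ : ℂ) + (y : ℂ) * Complex.I))))) := by
  have hQ := nestedQ_ofFn_mem_Ioo hk hx
  have hP : 0 < ∏ j, x j := Finset.prod_pos fun j _ => (hx j).1
  have hab : (a k).re < (b k).re := by linarith [lt_trans ht₀ ht₀']
  -- Lemma 2 in the unified form `eulerIntegral … z = c · (1/2π) ∫ K(y) · (|z|^s e^{iεπs})`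
  have hEuler : eulerIntegral a₀ (a k) (b k) ((((-1) ^ k * (∏ j, x j) / nestedQ (List.ofFn x) : ℝ)) : ℂ) =
      Complex.Gamma (b k - a k) / Complex.Gamma a₀ *
        ((1 / (2 * π) : ℂ) * ∫ y : ℝ,
          Complex.Gamma (a₀ + (-(t₀ : ℂ) + (y : ℂ) * Complex.I)) * Complex.Gamma (a k + (-(t₀ : ℂ) + (y : ℂ) * Complex.I)) *
              Complex.Gamma (-(-(t₀ : ℂ) + (y : ℂ) * Complex.I)) /
              Complex.Gamma (b k + (-(t₀ : ℂ) + (y : ℂ) * Complex.I)) *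
            (((((∏ j, x j) / nestedQ (List.ofFn x) : ℝ)) : ℂ) ^ (-(t₀ : ℂ) + (y : ℂ) * Complex.I) *
              Complex.exp (ε * π * Complex.I * (-(t₀ : ℂ) + (y : ℂ) * Complex.I)))) := by
    rcases hε with ⟨hodd, rfl⟩ | ⟨hev, hε⟩
    · -- `k` odd: `z = −ζ`, `ζ = ∏x_j/Q > 0`, Lemma 2 off the cut, no phase
      have hz : ((((-1) ^ k * (∏ j, x j) / nestedQ (List.ofFn x) : ℝ)) : ℂ) =
          -((((∏ j, x j) / nestedQ (List.ofFn x) : ℝ)) : ℂ) := by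
        rw [Odd.neg_one_pow hodd]; push_cast; ring
      rw [hz, BarnesEulerIntegral.eulerIntegral_neg_eq_barnes (div_pos hP hQ.1) ht₀ ht₀' hta hab]
      simp
    · -- `k` even: `0 < z < 1`, Lemma 2 on the cut, phase `e^{±iπs}`
      have hz := (z_sign hk hx).2 hev
      rw [Even.neg_one_pow hev, one_mul] at hz ⊢
      exact BarnesEulerIntegralCut.eulerIntegral_pos_eq_barnes ht₀ ht₀' hta hb hz.1 hz.2.le hε
  rw [hEuler, ← mul_assoc, mul_comm _ (Complex.Gamma (b k - a k) / Complex.Gamma a₀), mul_assoc, ← mul_assoc _ (1 / (2 * π) : ℂ),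
    mul_comm _ (1 / (2 * π) : ℂ), mul_assoc, ← integral_const_mul]
  congr 2
  refine integral_congr_ae (Eventually.of_forall fun y => ?_)
  simp only
  rw [← shifted_integrand_eq hk a₀ a b hx]
  ring

end Summit.KontsevichZagierPeriods.Zeta5Search.SorokinLemma3Fibre

end
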